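import Mathlib
import Summits.AtomisticToContinuum.HydrodynamicLimit.Theorems.ImplosionDichotomyDenseExcursionSonicCavityDefsB
import Summits.AtomisticToContinuum.HydrodynamicLimit.Theorems.ImplosionDichotomyDenseExcursionSonicConfinementContinuation

/-!
# `|Im Λ|`-confinement from sonic slaving and centre content: the assembly
# (crux `DenseExcursion`, line `sonic-cavity-renewal`, reduction of stub `stub_sonicConfinement`)

Helper file (`--supports stmt-AtomisticToContinuum-12586`, line lead a2, stub-worker for `stub_sonicConfinement`).

The stub `stub_sonicConfinement` (`IsMonatomicProfile → OrigProfileEqs → CavityTube → SonicConfinement`: every smooth radial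
mode with `−1/4 < Re Λ ≤ boxSide = 100` has `|Im Λ| ≤ boxTop = 1000`) is reduced here, by a checked three-line argument, to the TWO
quantitative statements of `…SonicCavityDefsB` about smooth radial modes at the matching point `x_m = matchPoint = −7/10` of the
core, phrased with the p-wave content observable `D = pWaveContent = p − ρ m` (`p = ŵ + 3ŝ`, `m = ŵ − 3ŝ`, `ρ = slavingCoeff`):

* `SonicSlaving r W S` (sonic half): `|Im Λ|·‖D‖ ≤ 2‖m(x_m)‖` for every smooth radial mode with `−1/4 < Re Λ ≤ boxSide`,
  `|Im Λ| > boxTop`;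
* `CentreContent r W S` (centre half): `‖m(x_m)‖ ≤ 250·‖D‖` for the same modes;
* `sonicConfinement_of_slaving_of_content` (registered helper, THIS FILE): `IsMonatomicProfile → CavityTube → SonicSlaving →
  CentreContent → SonicConfinement`. A mode with `|Im Λ| > 1000 > 2·250` would have `D = 0` and `m = 0`
  (`mode_eq_zero_at_matchPoint_of_slaving_of_content`, landed in `…SonicCavityDefsB`), i.e. `ŵ(x_m) = ŝ(x_m) = 0` with
  `x_m = −7/10 < 0`, contradicting unique continuation of smooth radial modes through the sonic point
  (`sonic_unique_continuation` / `smoothMode_ne_zero_on_neg`, landed in `…SonicConfinementContinuation`) and the non-triviality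
  clause of `IsSmoothRadialMode`.

Sources: Chen–Shkoller–Vicol arXiv:2605.00808 §1.10; Coppel 1965 Ch. IV; Olver 1974 Ch. 6, 12. NOT here: the two halves
(`sonicSlaving_of_tube`, `centreContent_of_tube`, other files).
-/

noncomputable section

open Set

namespace Summit.AtomisticToContinuum.HydrodynamicLimit.Theorems.SonicCavityRenewal

open Summit.AtomisticToContinuum.HydrodynamicLimit.Theorems.R2OneModeTwoConditions

/-- The matching point lies in the core: `matchPoint = −7/10 < 0`. [folklore] -/
theorem matchPoint_neg : matchPoint < 0 := by
  norm_num [matchPoint]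

/-- **THE ASSEMBLY** — registered helper `sonicConfinement_of_slaving_of_content` for `stub_sonicConfinement`: sonic slaving and
centre content imply the `|Im Λ|`-confinement. If a smooth radial mode had `−1/4 < Re Λ ≤ boxSide` and `|Im Λ| > boxTop = 1000`,
then `|Im Λ|‖D‖ ≤ 2‖m‖ ≤ 500‖D‖` forces `D = 0`, `m = 0`, `p = D + ρ m = 0`, so the mode vanishes at `x_m < 0` — impossible by unique
continuation through the sonic point (`sonic_unique_continuation`) and non-triviality of the mode. [folklore] -/
theorem sonicConfinement_of_slaving_of_content : ∀ (r : ℝ) (W S : ℝ → ℝ), IsMonatomicProfile r W S → CavityTube r W S → SonicSlaving r W S → CentreContent r W S → SonicConfinement r W S := by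
  intro r W S hP hT hslave hcontent Λ ŵ ŝ hmode hre₁ hre₂
  by_contra him
  push Not at him
  have h1 := hslave Λ ŵ ŝ hmode hre₁ hre₂ him
  have h2 := hcontent Λ ŵ ŝ hmode hre₁ hre₂ him
  obtain ⟨hw, hs⟩ := mode_eq_zero_at_matchPoint_of_slaving_of_content h1 h2 him
  have hall := sonic_unique_continuation r W S Λ ŵ ŝ hP hT hmode matchPoint matchPoint_neg hw hs
  obtain ⟨-, ⟨x, hx⟩, -⟩ := hmode
  rcases hx with hx | hx
  · exact hx (hall x).1
  · exact hx (hall x).2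

end Summit.AtomisticToContinuum.HydrodynamicLimit.Theorems.SonicCavityRenewal

end
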